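/- Copyright: the b2b-balaban cell (near-miss cell 7), T⁴-continuum fan-out; row NE7b ROUND-2 swarm, seat
t4-ne7b-formalise-leaf-01 (gen 9) (road W-RP, offer «W-2T» — journal INTENT l.17954; over W7 `HistoryChessboardGibbs`
p227659 of the owner's table `t4/b2b-balaban-t4-ne7b-p1/LEAVES-NE7b.md` v3.56; file 1 — files 2–4 `…GibbsCellsRoad` ∕ `…GibbsCellsTemplates` ∕ `…GibbsCollapse`).  Released under the licence of
the surrounding project. -/
import Summits.QuantumFields.BalabanUV.T4Continuum.Support.HistoryChessboardGibbs

/-!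
# Road W-RP: THE TWO-TERM EVENT MODEL, file 1 — the cell side produces W7's eleven clauses; the aggregate sandwich

Summits-side support leaf of the T⁴-continuum cell (rung (B)+1 on a FINITE torus only; NOT infinite volume, NOT the
mass gap, NOT the Clay statement; NOT a proof of the spine estimate NE7b).  Row NE7b, road **W-RP** (R-OWNER-23-2 ∕
R-OWNER-23-8), offer «W-2T», file 1, over W7 (`HistoryChessboardGibbsSide` p227394 ∕ `HistoryChessboardGibbs` p227659,
leaf-03 g5) BY NAME.  [folklore] set ∕ measure bookkeeping over the cell's OWN carriers; two hypothesis SHAPES (`CellSide`,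
`SmallFieldSandwich`: `Prop`-valued structures consumed only as binders, like W7's `GibbsCubeSide`); DATA definitions
`badEv` ∕ `twoEv` ∕ `twoT` (the weights are W7 v1.1's `weight`, p227970 — no third spelling); nothing printed asserted, no `[cite:]` tag, no `Prop`-valued FACT minted (c1),
no constant (c2∕c6), no exit ∕ socket ∕ `HistoryConstants` file touched (c3).  File 2 (`HistoryChessboardGibbsCellsRoad`)
builds W7's `ChessboardGibbsWitness` with TWO terms from a cell-road witness and draws the headline; file 3
(`…GibbsCellsTemplates`) plugs 4t's template cell events into `CellSide`; file 4 (`…GibbsCollapse`) proves that EVERY W7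
witness collapses to a two-term W7 witness (the term layer is eliminable).

WHY.  W7's witness displays, per run and cutoff, the ELEVEN clauses of `GibbsCubeSide` over an ABSTRACT term family (`T`,
weights `A`, bad class `Bad`, term events `ev`) and the cell events `E l c`, then NE7c's `ShellWeightBound` and NE7's
per-term `ReindexedBudget`.  The road's END uses the terms only through (a) the total weight of the bad class (chessboard:
`bad_sub` + `univ_le`), (b) the two-run sandwich on the GOOD terms, (c) the shells.  So the term layer carries nothing the
END needs beyond the DICHOTOMY «some cell event occurs ∕ none does»: given ONLY the cell events, DEFINE two terms per
cutoff (`ι := Bool`) — the LARGE-FIELD event `badEv P E := ⋃ l ∈ P, ⋃ c, E l c` (`true`) and the SMALL-FIELD event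
`(badEv P E)ᶜ` (`false`) —, weights W7 v1.1's `weight D g₀ os K (twoEv P E)` (`Zrun · ∫_{twoEv b} e^{t·obsTower} ∂gibbsTower`),
`Bad := {true}`, shells ZERO.  Then SIX of the eleven clauses are theorems ∕ definitions (`bad_subset`, `ev_meas`, `repr`
(`rfl`), `ev_cover`, `ev_disj`, `bad_sub`), NE7c's `ShellWeightBound` holds with `Wsh ≡ 0`, and NE7's `ReindexedBudget` has
ONE good term per cutoff — it IS the AGGREGATE two-run small-field sandwich.

WHAT.  §1 `badEv`, `twoEv` (+ measurability from `E_meas`), `weight_nonneg`; **`structure CellSide D g₀ hm₁ K P E r :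
Prop`** = the FIVE cell-event clauses of `GibbsCubeSide` ∕ `GibbsCubeEvents` TOKEN FOR TOKEN (`E_meas`, `loc`, `sym`,
`univ_le`, `r_nonneg`; no loop string, no terms — so 4t's cube producers and W-LAB's label events plug in with the proofs
they have); `CellSide.of_gibbsCubeEvents` ∕ `CellSide.of_gibbsCubeSide` (projections); **`CellSide.gibbsCubeEvents :
GibbsCubeEvents D g₀ hm₁ K P univ {true} (twoEv P E) E r`** (v1.1's string-independent ten-clause reading: the five term
clauses PRODUCED) and **`CellSide.gibbsCubeSide os : GibbsCubeSide D g₀ os hm₁ K P univ (weight D g₀ os K (twoEv P E)) {true}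
(twoEv P E) E r`** (`GibbsCubeEvents.side`, `repr := rfl`).
§2 `shellWeightBound_zero_of_nonneg` (zero shells for nonnegative families, any index type); **`structure
SmallFieldSandwich l₀ vol K₀ mA mB Cc Rr CcRec RrRec ν u s₂ c₀ rr s : Prop`** = the six inequalities of
`T4MatchingClosure.ReindexedBudget` for ONE term from `K₀` on (constants `ℕ → ℝ → ℝ`); `twoT K₀ K := if K₀ ≤ K then univ
else ∅`; **`reindexedBudget_of_sandwich`** (W7's NE7 binder for two-term families with zero shells and bad class `{true}`,
from the sandwich on the `false` term); **`sandwich_of_reindexedBudget`** (conversely ANY per-term `ReindexedBudget` gives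
the aggregate sandwich for the SUMS over its good terms — constant `c₀ + ν`, radius `vol·((rr+u)+(s+s₂))`, rates folded
into `rr`: on a given good mass the aggregate form asks nothing term by term, it is implied by every per-term budget).
§5 sanity: `CellSide` with no pattern is inhabited on the real tower at every cutoff, hence the two-term readings.

HONEST.  Nothing analytic is discharged: `univ_le` IS (U1)+(G2) ((B)'s lower half INSIDE as a reading) and the aggregate
sandwich IS NE7's content for the small-field event; which cell events (Bałaban's large-field conditions per cube, read on
the tower) is the typing identification.  NOTHING of the nine discharged; spine count 0∕9 UNCHANGED; NE7b NOT proved;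
finite T⁴ only.  HONEST DEPENDENCY (cell): continuum YM on T⁴ ⇐ BetaPertH ∧ nine spine estimates (0/9 proved); BetaPertH
⇐ (D1) ∧ (D4) ∧ CAP+tail; G-an2-4 gates asym, D1 and NE2/3/4.  This file changes none of it. -/

open Finset MeasureTheory
open Literature.Barriers.CriticalPhenomena.NonGibbs
open Literature.MathematicalPhysics.QuantumFieldTheory.Balaban1983to89
open Literature.MathematicalPhysics.QuantumFieldTheory.Balaban1983to89.Missing
open Literature.MathematicalPhysics.QuantumFieldTheory.Balaban1983to89.T4Continuum
open Literature.MathematicalPhysics.QuantumFieldTheory.Balaban1983to89.T4IndicatorShell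
open Literature.MathematicalPhysics.QuantumFieldTheory.Balaban1983to89.T4MatchingAssembly
open Literature.MathematicalPhysics.QuantumFieldTheory.Balaban1983to89.T4MatchingClosure
open Summit.QuantumFields.BalabanUV.T4Continuum
open HistoryRPTowerLaw HistoryChessboardEventsCubes HistoryChessboardTowerRepr HistoryChessboardApex
open HistoryChessboardHeadline HistoryChessboardGibbsSide HistoryChessboardGibbs

namespace Summit.QuantumFields.BalabanUV.T4Continuum.HistoryChessboardGibbsCells

noncomputable section

/-! ## §1 The two events generated by the cell events; the cell side -/

section Events

variable {F : T4Family} {G : Type*} {Λ : Type*} {m₁ K : ℕ}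

/-- **THE LARGE-FIELD EVENT of a family of cell events**: some cell event of some pattern occurs. -/
def badEv (P : Finset Λ) (E : Λ → BlockIdx 4 (cubeCount F m₁) → Set (Tower (F.P K) G K)) :
    Set (Tower (F.P K) G K) :=
  ⋃ l ∈ P, ⋃ c : BlockIdx 4 (cubeCount F m₁), E l c

/-- **THE TWO TERM EVENTS**: `true` ↦ the large-field event, `false` ↦ its complement (the small-field event). -/
def twoEv (P : Finset Λ) (E : Λ → BlockIdx 4 (cubeCount F m₁) → Set (Tower (F.P K) G K)) :
    Bool → Set (Tower (F.P K) G K)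
  | true => badEv P E
  | false => (badEv P E)ᶜ

variable [MeasurableSpace G] {P : Finset Λ} {E : Λ → BlockIdx 4 (cubeCount F m₁) → Set (Tower (F.P K) G K)}

/-- The large-field event is measurable when the cell events are. [folklore] -/
theorem measurableSet_badEv (hE : ∀ l ∈ P, ∀ c, MeasurableSet (E l c)) : MeasurableSet (badEv P E) :=
  Finset.measurableSet_biUnion P fun l hl => MeasurableSet.iUnion fun c => hE l hl c

/-- Both term events are measurable when the cell events are. [folklore] -/
theorem measurableSet_twoEv (hE : ∀ l ∈ P, ∀ c, MeasurableSet (E l c)) : ∀ b, MeasurableSet (twoEv P E b)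
  | true => measurableSet_badEv hE
  | false => (measurableSet_badEv hE).compl

end Events

section Cells

variable {F : T4Family} {G : Type*} [GaugeGroup G] [MeasurableSpace G] [HaarData G] {Λ : Type*} {m₁ K : ℕ}

/-- W7 v1.1's event weights are nonnegative (`Zrun > 0`, `e^{·} > 0`). [folklore] -/
theorem weight_nonneg [RegularGaugeGroup G] {ι : Type*} (D : FiniteEpsData F G) (g₀ : ℕ → ℝ) (os : List (ULoop F)) (K : ℕ)
    (ev : ι → Set (Tower (F.P K) G K)) (t : ℝ) (τ : ι) : 0 ≤ weight D g₀ os K ev t τ :=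
  mul_nonneg (Zrun_pos D K (g₀ K)).le (integral_nonneg fun _ => (Real.exp_pos _).le)

/-- **THE CELL SIDE OF ONE RUN AT ONE CUTOFF** (HYPOTHESIS SHAPE — NOTHING asserted): the FIVE clauses of W7's
`GibbsCubeSide` ∕ `GibbsCubeEvents` that speak of the CELL events only, TOKEN FOR TOKEN — measurability, (LOC) measurability of the positive half's cell events
for the positive algebra of each cube cut, (R-sym) reflection-relatedness, (U1)+(G2) the universally forced pattern has
probability `≤ r^(N^4)` under the run's Gibbs tower, `0 ≤ r`.  No loop string, no terms. [folklore] -/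
structure CellSide (D : FiniteEpsData F G) (g₀ : ℕ → ℝ) {m₁ : ℕ} (hm₁ : m₁ ≤ F.m) (K : ℕ) (P : Finset Λ)
    (E : Λ → BlockIdx 4 (cubeCount F m₁) → Set (Tower (F.P K) G K)) (r : ℝ) : Prop where
  /-- cell events are measurable -/
  E_meas : ∀ l ∈ P, ∀ c, MeasurableSet (E l c)
  /-- (LOC): the cell events of the positive half are measurable for the positive algebra of the cube cut -/
  loc : ∀ l ∈ P, ∀ (i : Fin 4) (k : ZMod (cubeCount F m₁)), ∀ c ∈ halfPlus (cubeCount F m₁) i k,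
    MeasurableSet[cubePos G (sitesPerDir_top_eq F hm₁ K) i k] (E l c)
  /-- (R-sym): the cell events are related by the cube-boundary reflections -/
  sym : ∀ l ∈ P, ∀ (i : Fin 4) (k : ZMod (cubeCount F m₁)) (c : BlockIdx 4 (cubeCount F m₁)),
    cubeRefl (sitesPerDir_top_eq F hm₁ K) i k ⁻¹' E l c = E l (cellReflect i k c)
  /-- (U1)+(G2), ratio currency: the universally forced pattern has probability `≤ r^(N^4)` -/
  univ_le : ∀ l ∈ P,
    (gibbsTower D g₀ K).real (⋂ c ∈ (Finset.univ : Finset (BlockIdx 4 (cubeCount F m₁))), E l c) ≤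
      r ^ (cubeCount F m₁ ^ 4)
  /-- the per-cell rate is nonnegative -/
  r_nonneg : 0 ≤ r

variable {D : FiniteEpsData F G} {g₀ : ℕ → ℝ} {hm₁ : m₁ ≤ F.m} {P : Finset Λ}
  {E : Λ → BlockIdx 4 (cubeCount F m₁) → Set (Tower (F.P K) G K)} {r : ℝ}

/-- The cell side is EXACTLY the cell-event part of W7 v1.1's events-only reading (projection). [folklore] -/
theorem CellSide.of_gibbsCubeEvents {ι : Type*} {T : Finset ι} {Bad : Finset ι} {ev : ι → Set (Tower (F.P K) G K)}
    (H : GibbsCubeEvents D g₀ hm₁ K P T Bad ev E r) : CellSide D g₀ hm₁ K P E r :=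
  ⟨H.E_meas, H.loc, H.sym, H.univ_le, H.r_nonneg⟩

/-- … and of W7's eleven-clause side (projection). [folklore] -/
theorem CellSide.of_gibbsCubeSide {ι : Type*} {os : List (ULoop F)} {T : Finset ι} {A : ℝ → ι → ℝ} {Bad : Finset ι}
    {ev : ι → Set (Tower (F.P K) G K)} (H : GibbsCubeSide D g₀ os hm₁ K P T A Bad ev E r) :
    CellSide D g₀ hm₁ K P E r :=
  ⟨H.E_meas, H.loc, H.sym, H.univ_le, H.r_nonneg⟩

/-- **THE FIVE TERM CLAUSES PRODUCED, STRING-INDEPENDENTLY**: the cell side gives W7 v1.1's ten-clause events-only reading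
`GibbsCubeEvents` for the TWO-TERM model — terms `univ : Finset Bool`, bad class `{true}`, events `twoEv` —: `bad_subset`
(trivial), `ev_meas` (`measurableSet_twoEv`), `ev_cover` ∕ `ev_disj` (an event and its complement), `bad_sub` (an
EQUALITY: the bad event IS the union of the cell events). [folklore] -/
theorem CellSide.gibbsCubeEvents (H : CellSide D g₀ hm₁ K P E r) :
    GibbsCubeEvents D g₀ hm₁ K P (Finset.univ : Finset Bool) {true} (twoEv P E) E r where
  bad_subset := Finset.subset_univ _
  ev_meas b _ := measurableSet_twoEv H.E_meas b
  E_meas := H.E_meas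
  ev_cover ω _ := by
    by_cases h : ω ∈ badEv P E
    · exact Set.mem_iUnion₂.2 ⟨true, Finset.mem_univ _, h⟩
    · exact Set.mem_iUnion₂.2 ⟨false, Finset.mem_univ _, h⟩
  ev_disj a _ b _ hab := by
    cases a <;> cases b
    · exact (hab rfl).elim
    · exact disjoint_compl_left
    · exact disjoint_compl_right
    · exact (hab rfl).elim
  bad_sub b hb := by
    rw [Finset.mem_singleton] at hb
    subst hb
    exact subset_rfl
  loc := H.loc
  sym := H.sym
  univ_le := H.univ_le
  r_nonneg := H.r_nonneg

/-- **W7's ELEVEN-CLAUSE SIDE FOR EVERY LOOP STRING**, weights DEFINED by v1.1's `weight` (`GibbsCubeEvents.side`,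
`repr := rfl`). [folklore] -/
theorem CellSide.gibbsCubeSide (H : CellSide D g₀ hm₁ K P E r) (os : List (ULoop F)) :
    GibbsCubeSide D g₀ os hm₁ K P (Finset.univ : Finset Bool) (weight D g₀ os K (twoEv P E)) {true} (twoEv P E) E r :=
  H.gibbsCubeEvents.side os

end Cells

/-! ## §2 Zero shells; the aggregate small-field sandwich ⇔ NE7's one-term budget -/

section Sandwich

/-- **ZERO SHELLS** (any index type): for families nonnegative on their terms, NE7c's `ShellWeightBound` holds with shell
parts `0` and shell weights `Wsh ≡ 0`. [folklore] -/
theorem shellWeightBound_zero_of_nonneg {ι : Type*} {l₀ : ℝ} {T : ℕ → Finset ι} {A B : ℕ → ℝ → ι → ℝ}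
    (hA : ∀ K t, ∀ τ ∈ T K, 0 ≤ A K t τ) (hB : ∀ K t, ∀ τ ∈ T K, 0 ≤ B K t τ) :
    ShellWeightBound l₀ T A B (fun _ _ _ => 0) (fun _ _ _ => 0) fun _ => 0 where
  nonneg _ := le_rfl
  summable := summable_zero
  sh_nonneg_left _ _ _ _ _ := le_rfl
  sh_le_left K t _ τ hτ := hA K t τ hτ
  sh_nonneg_right _ _ _ _ _ := le_rfl
  sh_le_right K t _ τ hτ := hB K t τ hτ
  left _ _ _ := by simp
  right _ _ _ := by simp

/-- **THE AGGREGATE TWO-RUN SMALL-FIELD SANDWICH** (HYPOTHESIS SHAPE — NOTHING asserted): the six inequalities of NE7's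
`ReindexedBudget` for ONE term from the threshold `K₀` on, for two mass families `mA K t` (run A, `K` steps) and `mB K t`
(run B, `K + 1` steps) on the source window `|t| ≤ l₀`: `e^{Cc − Rr}·mA ≤ mB ≤ e^{Cc + Rr}·mA`, the UV constant ONE number
`ν K` per cutoff up to `vol·s₂` around the recent constant `CcRec`, itself within `vol·s` of the class constant `c₀ K`,
radii `Rr ≤ RrRec + vol·u`, `RrRec ≤ vol·rr`. [folklore] -/
structure SmallFieldSandwich (l₀ vol : ℝ) (K₀ : ℕ) (mA mB : ℕ → ℝ → ℝ) (Cc Rr CcRec RrRec : ℕ → ℝ → ℝ)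
    (ν u s₂ c₀ rr s : ℕ → ℝ) : Prop where
  /-- lower half of the sandwich -/
  lower : ∀ K t, |t| ≤ l₀ → K₀ ≤ K → Real.exp (Cc K t - Rr K t) * mA K t ≤ mB K t
  /-- upper half of the sandwich -/
  upper : ∀ K t, |t| ≤ l₀ → K₀ ≤ K → mB K t ≤ Real.exp (Cc K t + Rr K t) * mA K t
  /-- the UV constant is one number `ν K` per cutoff, up to `vol·s₂ K` -/
  uv_const : ∀ K t, |t| ≤ l₀ → K₀ ≤ K → |Cc K t - (CcRec K t + ν K)| ≤ vol * s₂ K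
  /-- the UV radius per unit volume -/
  uv_radius : ∀ K t, |t| ≤ l₀ → K₀ ≤ K → Rr K t ≤ RrRec K t + vol * u K
  /-- the recent radius per unit volume -/
  recent_remainder : ∀ K t, |t| ≤ l₀ → K₀ ≤ K → RrRec K t ≤ vol * rr K
  /-- the recent constant against the class constant -/
  recent_deviation : ∀ K t, |t| ≤ l₀ → K₀ ≤ K → |CcRec K t - c₀ K| ≤ vol * s K

/-- **THE TWO-TERM FAMILY FROM THE THRESHOLD ON**: both terms from `K₀` on, none before. -/
def twoT (K₀ K : ℕ) : Finset Bool := if K₀ ≤ K then Finset.univ else ∅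

/-- From the threshold on the two-term family is `univ`. [folklore] -/
theorem twoT_of_le {K₀ K : ℕ} (hK : K₀ ≤ K) : twoT K₀ K = Finset.univ := if_pos hK

/-- A good term of the two-term family is the `false` term at a cutoff past the threshold. [folklore] -/
theorem le_and_eq_false_of_mem {K₀ K : ℕ} {b : Bool} (h : b ∈ twoT K₀ K \ {true}) : K₀ ≤ K ∧ b = false := by
  unfold twoT at h
  by_cases hK : K₀ ≤ K
  · rw [if_pos hK] at h
    cases b
    · exact ⟨hK, rfl⟩
    · simp at h
  · rw [if_neg hK] at h
    simp at h

variable {l₀ vol : ℝ} {K₀ : ℕ} {Cc Rr CcRec RrRec : ℕ → ℝ → ℝ} {ν u s₂ c₀ rr s : ℕ → ℝ}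

/-- **NE7's BINDER OF W7's WITNESS FROM THE AGGREGATE SANDWICH**: for two-term families (`T := twoT K₀`, bad class
`{true}`, zero shells) whose run-A family is nonnegative, the sandwich on the `false` terms IS `ReindexedBudget` (constants
constant in the term). [folklore] -/
theorem reindexedBudget_of_sandwich {A B : ℕ → ℝ → Bool → ℝ} (hA : ∀ K t b, 0 ≤ A K t b)
    (h : SmallFieldSandwich l₀ vol K₀ (fun K t => A K t false) (fun K t => B K t false) Cc Rr CcRec RrRec ν u s₂ c₀
      rr s) :
    ReindexedBudget l₀ vol (twoT K₀) (fun K t b => A K t b - 0) (fun K t b => B K t b - 0) (fun _ _ => {true})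
      (fun K t _ => Cc K t) (fun K t _ => Rr K t) (fun K t _ => CcRec K t) (fun K t _ => RrRec K t) ν u s₂ c₀ rr s where
  nonneg K t _ b _ := by
    rw [sub_zero]
    exact hA K t b
  lower K t ht b hb := by
    obtain ⟨hK, rfl⟩ := le_and_eq_false_of_mem hb
    simpa only [sub_zero] using h.lower K t ht hK
  upper K t ht b hb := by
    obtain ⟨hK, rfl⟩ := le_and_eq_false_of_mem hb
    simpa only [sub_zero] using h.upper K t ht hK
  uv_const K t ht b hb := h.uv_const K t ht (le_and_eq_false_of_mem hb).1
  uv_radius K t ht b hb := h.uv_radius K t ht (le_and_eq_false_of_mem hb).1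
  recent_remainder K t ht b hb := h.recent_remainder K t ht (le_and_eq_false_of_mem hb).1
  recent_deviation K t ht b hb := h.recent_deviation K t ht (le_and_eq_false_of_mem hb).1

/-- **CONVERSELY, ANY PER-TERM BUDGET GIVES THE AGGREGATE SANDWICH** for the SUMS over its good terms, with the constant
`c₀ K + ν K`, the radius `vol·((rr + u) + (s + s₂))` and all rates folded into `rr` (threshold `0`): on a given good mass
the aggregate form is implied by every per-term form of NE7's binder (it asks nothing term by term). [folklore] -/
theorem sandwich_of_reindexedBudget {ι : Type*} [DecidableEq ι] {T : ℕ → Finset ι} {A B : ℕ → ℝ → ι → ℝ}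
    {Bad : ℕ → ℝ → Finset ι} {Cc Rr CcRec RrRec : ℕ → ℝ → ι → ℝ}
    (h : ReindexedBudget l₀ vol T A B Bad Cc Rr CcRec RrRec ν u s₂ c₀ rr s) :
    SmallFieldSandwich l₀ vol 0 (fun K t => ∑ τ ∈ T K \ Bad K t, A K t τ) (fun K t => ∑ τ ∈ T K \ Bad K t, B K t τ)
      (fun K _ => c₀ K + ν K) (fun K _ => vol * ((rr K + u K) + (s K + s₂ K))) (fun K _ => c₀ K)
      (fun K _ => vol * ((rr K + u K) + (s K + s₂ K))) ν 0 0 c₀ (fun K => (rr K + u K) + (s K + s₂ K)) 0 where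
  lower K t ht _ := by
    rw [Finset.mul_sum]
    refine Finset.sum_le_sum fun τ hτ => (mul_le_mul_of_nonneg_right (Real.exp_le_exp.2 ?_)
      (h.nonneg K t ht τ hτ)).trans (h.lower K t ht τ hτ)
    have e1 := (abs_le.mp (h.uv_const K t ht τ hτ)).1
    have e2 := (abs_le.mp (h.recent_deviation K t ht τ hτ)).1
    have e5 : vol * ((rr K + u K) + (s K + s₂ K)) = vol * rr K + vol * u K + (vol * s K + vol * s₂ K) := by ring
    linarith [h.uv_radius K t ht τ hτ, h.recent_remainder K t ht τ hτ]
  upper K t ht _ := by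
    rw [Finset.mul_sum]
    refine Finset.sum_le_sum fun τ hτ => (h.upper K t ht τ hτ).trans
      (mul_le_mul_of_nonneg_right (Real.exp_le_exp.2 ?_) (h.nonneg K t ht τ hτ))
    have e1 := (abs_le.mp (h.uv_const K t ht τ hτ)).2
    have e2 := (abs_le.mp (h.recent_deviation K t ht τ hτ)).2
    have e5 : vol * ((rr K + u K) + (s K + s₂ K)) = vol * rr K + vol * u K + (vol * s K + vol * s₂ K) := by ring
    linarith [h.uv_radius K t ht τ hτ, h.recent_remainder K t ht τ hτ]
  uv_const K t _ _ := by simp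
  uv_radius K t _ _ := by simp
  recent_remainder K t _ _ := le_rfl
  recent_deviation K t _ _ := by simp

end Sandwich

/-! ## §5 Sanity: the cell side with no pattern is inhabited on the real tower, hence the two-term readings -/

namespace Sanity

variable {F : T4Family} {G : Type*} [GaugeGroup G] [MeasurableSpace G] [HaarData G]

/-- The five clauses of `CellSide` are JOINTLY INHABITED at every cutoff on the data's own Gibbs tower — NO pattern, any
cell events, rate `0` — and then so are the two-term `GibbsCubeEvents` and, for every loop string, `GibbsCubeSide`
(large-field event EMPTY, small-field event the whole tower).  A node test of the SHAPE; Bałaban's patterns, cell events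
and rates are the displayed reading. [folklore] -/
example (D : FiniteEpsData F G) (g₀ : ℕ → ℝ) (os : List (ULoop F)) {m₁ : ℕ} (hm₁ : m₁ ≤ F.m) (K : ℕ)
    (E : Unit → BlockIdx 4 (cubeCount F m₁) → Set (Tower (F.P K) G K)) :
    CellSide D g₀ hm₁ K ∅ E 0 ∧ GibbsCubeEvents D g₀ hm₁ K ∅ (Finset.univ : Finset Bool) {true} (twoEv ∅ E) E 0 ∧
      GibbsCubeSide D g₀ os hm₁ K ∅ (Finset.univ : Finset Bool) (weight D g₀ os K (twoEv ∅ E)) {true} (twoEv ∅ E) E 0 :=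
  have h : CellSide D g₀ hm₁ K ∅ E 0 :=
    { E_meas := fun _ h => (Finset.notMem_empty _ h).elim
      loc := fun _ h => (Finset.notMem_empty _ h).elim
      sym := fun _ h => (Finset.notMem_empty _ h).elim
      univ_le := fun _ h => (Finset.notMem_empty _ h).elim
      r_nonneg := le_rfl }
  ⟨h, h.gibbsCubeEvents, h.gibbsCubeSide os⟩

end Sanity

end

end Summit.QuantumFields.BalabanUV.T4Continuum.HistoryChessboardGibbsCells
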